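import Summits.AtomisticToContinuum.HydrodynamicLimit.Theses.OneFlightGossipEngine
import Summits.AtomisticToContinuum.HydrodynamicLimit.Theorems.BoltzmannGreenKubo.Negative.ForallN
import Summits.AtomisticToContinuum.HydrodynamicLimit.Theorems.KineticFluxLdDecay.Negative.TiltBasics
import Literature.MathematicalPhysics.KineticTheory.HardSphereEulerProofs
import Summits.AtomisticToContinuum.HydrodynamicLimit.Theorems.OneFlightGossipEngineKineticCurrentsWindowLDUniformClassTruncationReduced

/-!
# `KineticCurrentsWindowLDUniform`: the hypothesis `F ⊥ ‖v‖²` is REDUNDANT (implied by `F ⊥ 1` and `F ⊥ v_j`)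

Structural (positive) knowledge about the HYPOTHESES of the crux `OneFlightGossipEngine.KineticCurrentsWindowLDUniform`
(stmt-AtomisticToContinuum-14662), from the standing disprover's `Cruxes/KineticCurrentsWindowLDUniform/Disproof.lean`
§ 2 (it asserts no Theses decl). For the crux's class `F(v) = ∑_{jk} A_{jk} w_j w_k + (∑_j b_j w_j) G(‖w‖²)`,
`w = v − u`, with `|F| ≤ C(1 + ‖v‖²)` and `G` continuous, at a fixed point `x` (`u = u₀(x)`, `θ = θ₀(x) > 0`):
`∫ F M_{1,u,θ} = 0` and `∫ F v_k M_{1,u,θ} = 0 (k = 0,1,2)` IMPLY `∫ F ‖v‖² M_{1,u,θ} = 0`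
(`orth_energy_of_orth_one_of_orth_mom`), hence the crux's third orthogonality hypothesis follows from the first
two (`kcw_orth_energy_redundant`, in the exact form of the crux). Proof (Gaussian moment algebra, values not
needed): after `v = u + √θ ξ`, `ξ ∼ γ`, `‖v‖² = θ‖ξ‖² + 2⟪v,u⟫ − ‖u‖²` reduces `∫F‖v‖²M` to `θ ∫ F(u+√θξ)‖ξ‖² dγ`;
symmetrising in `ξ ↦ −ξ` kills the odd `b`-part: `F(u+√θξ) + F(u−√θξ) = 2θ ξᵀAξ`; off-diagonal moments
`E[ξ_jξ_k κ(‖ξ‖²)]` vanish by the coordinate reflections and the diagonal ones agree by coordinate swaps, so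
`∫ ξᵀAξ · κ(‖ξ‖²) dγ = m_κ · tr A`; the first hypothesis gives `θ · tr A · E[ξ₀²] = 0`, so `tr A = 0` and
everything vanishes (reflections/swaps and `integral_quad_weight` reused from the line's
`…ClassTruncationGauss/Reduced` helper files, which adapted them from this seat's Disproof.lean). By-product:
`∫ F M_{1,u,θ} = θ tr A` (`integral_classF`). Consequences: provers may discharge
hypothesis (3) of KCW for free when applying it; planners may delete it. refuter-cdisprove-stmt-AtomisticToContinuum-14662-0.
-/

noncomputable section

namespace Summit.AtomisticToContinuum.HydrodynamicLimit.Theorems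
namespace KineticCurrentsWindowLDUniformClass

open MeasureTheory ProbabilityTheory Real
open scoped ENNReal InnerProductSpace
open Literature.Analysis.FluidPDE Literature.MathematicalPhysics.KineticTheory
open BoltzmannGreenKuboForallN (reflB reflB_apply integral_stdGaussian_eq_zero_of_odd norm_sq_eq_three inner_eq_three)
open KineticFluxLdDecayTilt (integral_comp_linearIsometryEquiv_stdGaussian)
open KineticCurrentsWindowLDUniformSketch.ClassTruncation (integral_offdiag_eq_zero integral_diag_eq
  integral_quad_weight integral_mul_localMaxwellian_shift)

/-! ### The class functional at a point and its reduced quadratic part -/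

/-- The crux's functional at a fixed macroscopic point: `F(v) = ∑ A_{jk} w_j w_k + (∑ b_j w_j) G(‖w‖²)`, `w = v − u`. -/
def classF (u : V3) (A : Fin 3 → Fin 3 → ℝ) (b : V3) (G : ℝ → ℝ) (v : V3) : ℝ :=
  (∑ j, ∑ k, A j k * ((v - u) j * (v - u) k)) + (∑ j, b j * (v - u) j) * G (‖v - u‖ ^ 2)

variable (u : V3) (A : Fin 3 → Fin 3 → ℝ) (b : V3) (G : ℝ → ℝ)

/-- The class functional in the reduced variable `v = u + s ξ`, `s² = θ`. [folklore] -/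
theorem classF_shift' {θ s : ℝ} (hs : s * s = θ) (ξ : V3) :
    classF u A b G (u + s • ξ) = θ * (∑ j, ∑ k, A j k * (ξ j * ξ k)) + s * (∑ j, b j * ξ j) * G (θ * ‖ξ‖ ^ 2) := by
  have hn : ‖s • ξ‖ ^ 2 = θ * ‖ξ‖ ^ 2 := by
    rw [norm_smul, mul_pow, Real.norm_eq_abs, sq_abs, sq, hs]
  simp only [classF, add_sub_cancel_left, hn, PiLp.smul_apply, smul_eq_mul, Finset.mul_sum]
  congr 1
  · refine Finset.sum_congr rfl fun j _ => Finset.sum_congr rfl fun k _ => ?_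
    rw [← hs]; ring
  · rw [Finset.sum_mul, Finset.sum_mul]
    refine Finset.sum_congr rfl fun j _ => ?_
    ring

/-- The class functional in the reduced variable `v = u + √θ ξ`. [folklore] -/
theorem classF_shift {θ : ℝ} (hθ : 0 < θ) (ξ : V3) :
    classF u A b G (u + Real.sqrt θ • ξ) =
      θ * (∑ j, ∑ k, A j k * (ξ j * ξ k)) + Real.sqrt θ * (∑ j, b j * ξ j) * G (θ * ‖ξ‖ ^ 2) :=
  classF_shift' u A b G (Real.mul_self_sqrt hθ.le) ξ

/-- Symmetrisation kills the odd part: `F(u + √θξ) + F(u − √θξ) = 2θ q(ξ)`. [folklore] -/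
theorem classF_shift_add_neg {θ : ℝ} (hθ : 0 < θ) (ξ : V3) :
    classF u A b G (u + Real.sqrt θ • ξ) + classF u A b G (u + Real.sqrt θ • (-ξ)) =
      2 * θ * ∑ j, ∑ k, A j k * (ξ j * ξ k) := by
  rw [classF_shift u A b G hθ, classF_shift u A b G hθ]
  have hq : (∑ j, ∑ k, A j k * ((-ξ) j * (-ξ) k)) = ∑ j, ∑ k, A j k * (ξ j * ξ k) := by simp
  have hl : (∑ j, b j * (-ξ) j) = -∑ j, b j * ξ j := by simp [Finset.sum_neg_distrib]
  rw [hq, hl, norm_neg]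
  ring

/-! ### Gaussian integrability of observables of quartic growth -/

/-- `ξ ↦ (1 + ‖ξ‖²)²` is integrable under the standard Gaussian. [folklore] -/
theorem integrable_one_add_norm_sq_sq :
    Integrable (fun ξ : V3 => (1 + ‖ξ‖ ^ 2) ^ 2) (stdGaussian V3) := by
  have h : (fun ξ : V3 => (1 + ‖ξ‖ ^ 2) ^ 2) = fun ξ => 1 + 2 * ‖ξ‖ ^ 2 + ‖ξ‖ ^ 4 := by
    funext ξ; ring
  rw [h]
  exact ((integrable_const _).add (integrable_norm_sq_stdGaussian.const_mul 2)).add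
    integrable_norm_pow_four_stdGaussian

/-- Domination by `K(1 + ‖ξ‖²)²` gives Gaussian integrability. [folklore] -/
theorem integrable_of_le_quartic {h : V3 → ℝ} (hm : AEStronglyMeasurable h (stdGaussian V3)) (K : ℝ)
    (hh : ∀ ξ, |h ξ| ≤ K * (1 + ‖ξ‖ ^ 2) ^ 2) : Integrable h (stdGaussian V3) :=
  (integrable_one_add_norm_sq_sq.const_mul K).mono' hm (ae_of_all _ fun ξ => by
    rw [Real.norm_eq_abs]; exact hh ξ)

/-- `C ≥ 0` for a growth constant. [folklore] -/
theorem C_nonneg {C : ℝ} (hC : ∀ v, |classF u A b G v| ≤ C * (1 + ‖v‖ ^ 2)) : 0 ≤ C := by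
  have h0 := (abs_nonneg _).trans (hC 0)
  have : 0 < (1 : ℝ) + ‖(0 : V3)‖ ^ 2 := by positivity
  nlinarith

/-- Growth of the shifted functional: `|F(u + √θξ)| ≤ C(1 + 2‖u‖² + 2θ)(1 + ‖ξ‖²)`. [folklore] -/
theorem abs_classF_shift_le {θ : ℝ} (hθ : 0 < θ) {C : ℝ} (hC : ∀ v, |classF u A b G v| ≤ C * (1 + ‖v‖ ^ 2))
    (ξ : V3) :
    |classF u A b G (u + Real.sqrt θ • ξ)| ≤ C * (1 + 2 * ‖u‖ ^ 2 + 2 * θ) * (1 + ‖ξ‖ ^ 2) := by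
  have hC0 := C_nonneg u A b G hC
  refine (hC _).trans ?_
  rw [mul_assoc]
  refine mul_le_mul_of_nonneg_left ?_ hC0
  have h := KineticCurrentsWindowLDUniformSketch.ClassTruncation.norm_shift_sq_le hθ.le u ξ
  nlinarith [mul_nonneg hθ.le (sq_nonneg ‖ξ‖), sq_nonneg ‖u‖, sq_nonneg ‖ξ‖,
    mul_nonneg (sq_nonneg ‖u‖) (sq_nonneg ‖ξ‖)]

/-- The shifted functional is continuous when `G` is. [folklore] -/
theorem continuous_classF_shift (θ : ℝ) (hG : Continuous G) :
    Continuous fun ξ : V3 => classF u A b G (u + Real.sqrt θ • ξ) := by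
  unfold classF
  fun_prop

/-- Integrability of `F(u+√θξ) · p(ξ)` for a continuous weight of quadratic growth `|p| ≤ P(1+‖ξ‖²)`. [folklore] -/
theorem integrable_classF_shift_mul {θ : ℝ} (hθ : 0 < θ) {C : ℝ}
    (hC : ∀ v, |classF u A b G v| ≤ C * (1 + ‖v‖ ^ 2)) (hG : Continuous G) {p : V3 → ℝ} (hp : Continuous p)
    {P : ℝ} (hP : ∀ ξ, |p ξ| ≤ P * (1 + ‖ξ‖ ^ 2)) :
    Integrable (fun ξ : V3 => classF u A b G (u + Real.sqrt θ • ξ) * p ξ) (stdGaussian V3) := by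
  refine integrable_of_le_quartic ((continuous_classF_shift u A b G θ hG).mul hp).aestronglyMeasurable
    (C * (1 + 2 * ‖u‖ ^ 2 + 2 * θ) * P) fun ξ => ?_
  rw [abs_mul]
  have h1 := abs_classF_shift_le u A b G hθ hC ξ
  have h2 := hP ξ
  have hK : 0 ≤ C * (1 + 2 * ‖u‖ ^ 2 + 2 * θ) * (1 + ‖ξ‖ ^ 2) :=
    mul_nonneg (mul_nonneg (C_nonneg u A b G hC) (by positivity)) (by positivity)
  calc |classF u A b G (u + Real.sqrt θ • ξ)| * |p ξ|
      ≤ (C * (1 + 2 * ‖u‖ ^ 2 + 2 * θ) * (1 + ‖ξ‖ ^ 2)) * (P * (1 + ‖ξ‖ ^ 2)) :=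
        mul_le_mul h1 h2 (abs_nonneg _) hK
    _ = C * (1 + 2 * ‖u‖ ^ 2 + 2 * θ) * P * (1 + ‖ξ‖ ^ 2) ^ 2 := by ring

/-! ### Symmetrisation under the Gaussian -/

/-- **Symmetrised reduced integrals**: for an EVEN continuous weight `p` of quadratic growth,
`∫ F(u+√θξ) p(ξ) dγ = θ ∫ q(ξ) p(ξ) dγ` — the odd `b`-part drops out. [folklore] -/
theorem integral_classF_shift_mul_even {θ : ℝ} (hθ : 0 < θ) {C : ℝ}
    (hC : ∀ v, |classF u A b G v| ≤ C * (1 + ‖v‖ ^ 2)) (hG : Continuous G) {p : V3 → ℝ} (hp : Continuous p)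
    (heven : ∀ ξ, p (-ξ) = p ξ) {P : ℝ} (hP : ∀ ξ, |p ξ| ≤ P * (1 + ‖ξ‖ ^ 2)) :
    ∫ ξ, classF u A b G (u + Real.sqrt θ • ξ) * p ξ ∂stdGaussian V3 =
      θ * ∫ ξ, (∑ j, ∑ k, A j k * (ξ j * ξ k)) * p ξ ∂stdGaussian V3 := by
  set Fp : V3 → ℝ := fun ξ => classF u A b G (u + Real.sqrt θ • ξ) * p ξ with hFp
  have hi : Integrable Fp (stdGaussian V3) := integrable_classF_shift_mul u A b G hθ hC hG hp hP
  have hmp : MeasurePreserving (LinearIsometryEquiv.neg ℝ (E := V3)) (stdGaussian V3) (stdGaussian V3) :=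
    ⟨(LinearIsometryEquiv.neg ℝ (E := V3)).continuous.measurable, stdGaussian_map _⟩
  have hi' : Integrable (fun ξ => Fp (-ξ)) (stdGaussian V3) :=
    (hmp.integrable_comp_emb (LinearIsometryEquiv.neg ℝ (E := V3)).toHomeomorph.measurableEmbedding).2 hi
  have hsym : ∫ ξ, Fp ξ ∂stdGaussian V3 = ∫ ξ, Fp (-ξ) ∂stdGaussian V3 :=
    (integral_comp_linearIsometryEquiv_stdGaussian (LinearIsometryEquiv.neg ℝ (E := V3)) Fp).symm
  have h2 : ∫ ξ, Fp ξ ∂stdGaussian V3 + ∫ ξ, Fp (-ξ) ∂stdGaussian V3 =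
      ∫ ξ, 2 * θ * ((∑ j, ∑ k, A j k * (ξ j * ξ k)) * p ξ) ∂stdGaussian V3 := by
    rw [← integral_add hi hi']
    refine integral_congr_ae (ae_of_all _ fun ξ => ?_)
    have := classF_shift_add_neg u A b G hθ ξ
    simp only [hFp, heven]
    rw [← add_mul, this]
    ring
  rw [integral_const_mul] at h2
  have : ∫ ξ, Fp ξ ∂stdGaussian V3 = θ * ∫ ξ, (∑ j, ∑ k, A j k * (ξ j * ξ k)) * p ξ ∂stdGaussian V3 := by
    linarith
  simpa [hFp] using this

/-! ### The redundancy -/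

/-- **`∫ F M_{1,u,θ} = θ · tr A`** (symmetrisation with `p = 1`, reduced second moments `E[ξ₀²] = 1`). [folklore] -/
theorem integral_classF {θ : ℝ} (hθ : 0 < θ) {C : ℝ} (hC : ∀ v, |classF u A b G v| ≤ C * (1 + ‖v‖ ^ 2))
    (hG : Continuous G) :
    ∫ v, classF u A b G v * localMaxwellian 1 θ u v = θ * ∑ j, A j j := by
  rw [integral_mul_localMaxwellian_shift hθ u]
  have h := integral_classF_shift_mul_even u A b G hθ hC hG continuous_const (p := fun _ => (1 : ℝ))
    (fun _ => rfl) (P := 1) (fun ξ => by rw [abs_one]; nlinarith [sq_nonneg ‖ξ‖])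
  have hq := integral_quad_weight A (ω := fun _ => (1 : ℝ)) continuous_const (P := 1)
    (fun s hs => by rw [abs_one]; nlinarith)
  simp only [mul_one] at h hq
  rw [h, hq, show (∫ ξ : V3, ξ 0 * ξ 0 ∂stdGaussian V3) = 1 by
    simpa [sq] using integral_coord_sq_stdGaussian (ι := Fin 3) 0, mul_one]

/-- `∫ F(u+√θξ) ‖ξ‖² dγ = θ · tr A · E[ξ₀²‖ξ‖²]` (symmetrisation with `p = ‖ξ‖²`). [folklore] -/
theorem integral_classF_shift_mul_norm_sq {θ : ℝ} (hθ : 0 < θ) {C : ℝ}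
    (hC : ∀ v, |classF u A b G v| ≤ C * (1 + ‖v‖ ^ 2)) (hG : Continuous G) :
    ∫ ξ, classF u A b G (u + Real.sqrt θ • ξ) * ‖ξ‖ ^ 2 ∂stdGaussian V3 =
      θ * ((∑ j, A j j) * ∫ ξ, ξ 0 * ξ 0 * ‖ξ‖ ^ 2 ∂stdGaussian V3) := by
  rw [integral_classF_shift_mul_even u A b G hθ hC hG (p := fun ξ : V3 => ‖ξ‖ ^ 2) (by fun_prop)
    (fun ξ => by rw [norm_neg]) (P := 1) (fun ξ => by rw [abs_of_nonneg (sq_nonneg _)]; nlinarith [sq_nonneg ‖ξ‖]),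
    integral_quad_weight A (ω := fun s => s) continuous_id (P := 1) (fun s hs => by rw [abs_of_nonneg hs]; nlinarith)]

/-- **THE REDUNDANCY.** For `θ > 0`, `u ∈ ℝ³`, any coefficients `A`, `b`, continuous `G` and the class functional
`F = classF u A b G` with `|F| ≤ C(1+‖v‖²)`: `F ⊥ 1` and `F ⊥ v_k (k = 0,1,2)` under `M_{1,u,θ}` imply
`F ⊥ ‖v‖²`. [folklore] -/
theorem orth_energy_of_orth_one_of_orth_mom {θ : ℝ} (hθ : 0 < θ) {C : ℝ}
    (hC : ∀ v, |classF u A b G v| ≤ C * (1 + ‖v‖ ^ 2)) (hG : Continuous G)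
    (h1 : ∫ v, classF u A b G v * localMaxwellian 1 θ u v = 0)
    (h2 : ∀ k : Fin 3, ∫ v, classF u A b G v * v k * localMaxwellian 1 θ u v = 0) :
    ∫ v, classF u A b G v * ‖v‖ ^ 2 * localMaxwellian 1 θ u v = 0 := by
  -- `tr A = 0` from the first hypothesis
  have htr : ∑ j, A j j = 0 := by
    rw [integral_classF u A b G hθ hC hG] at h1
    rcases mul_eq_zero.1 h1 with h | h
    · exact absurd h hθ.ne'
    · exact h
  -- pass to the reduced variable
  rw [integral_mul_localMaxwellian_shift hθ u]
  have h2' : ∀ k : Fin 3, ∫ ξ, classF u A b G (u + Real.sqrt θ • ξ) * (u + Real.sqrt θ • ξ) k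
      ∂stdGaussian V3 = 0 := fun k => by
    rw [← integral_mul_localMaxwellian_shift hθ u (fun v => classF u A b G v * v k)]
    exact h2 k
  have h1' : ∫ ξ, classF u A b G (u + Real.sqrt θ • ξ) ∂stdGaussian V3 = 0 := by
    rw [← integral_mul_localMaxwellian_shift hθ u (classF u A b G)]
    exact h1
  -- `‖v‖² = θ‖ξ‖² + 2 ∑ u_k v_k − ‖u‖²`
  have hdec : ∀ ξ : V3, ‖u + Real.sqrt θ • ξ‖ ^ 2 =
      θ * ‖ξ‖ ^ 2 + 2 * (∑ k, u k * (u + Real.sqrt θ • ξ) k) - ‖u‖ ^ 2 := by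
    intro ξ
    have hin : ⟪u + Real.sqrt θ • ξ, u⟫_ℝ = ∑ k, u k * (u + Real.sqrt θ • ξ) k := by
      rw [inner_eq_three, Fin.sum_univ_three]; ring
    have hns : ‖Real.sqrt θ • ξ‖ ^ 2 = θ * ‖ξ‖ ^ 2 := by
      rw [norm_smul, mul_pow, Real.norm_eq_abs, sq_abs, Real.sq_sqrt hθ.le]
    have := norm_sub_sq_real (u + Real.sqrt θ • ξ) u
    rw [add_sub_cancel_left, hns, hin] at this
    linarith
  -- integrability of the three pieces
  have hiN : Integrable (fun ξ : V3 => classF u A b G (u + Real.sqrt θ • ξ) * ‖ξ‖ ^ 2) (stdGaussian V3) :=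
    integrable_classF_shift_mul u A b G hθ hC hG (by fun_prop) (P := 1)
      (fun ξ => by rw [abs_of_nonneg (sq_nonneg _)]; nlinarith [sq_nonneg ‖ξ‖])
  have hi1 : Integrable (fun ξ : V3 => classF u A b G (u + Real.sqrt θ • ξ)) (stdGaussian V3) := by
    have := integrable_classF_shift_mul u A b G hθ hC hG continuous_const (p := fun _ => (1 : ℝ)) (P := 1)
      (fun ξ => by rw [abs_one]; nlinarith [sq_nonneg ‖ξ‖])
    simpa using this
  have hik : ∀ k : Fin 3, Integrable (fun ξ : V3 => classF u A b G (u + Real.sqrt θ • ξ) *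
      (u + Real.sqrt θ • ξ) k) (stdGaussian V3) := by
    intro k
    refine integrable_classF_shift_mul u A b G hθ hC hG (by fun_prop) (P := ‖u‖ + Real.sqrt θ) fun ξ => ?_
    have hk : |(u + Real.sqrt θ • ξ) k| ≤ ‖u + Real.sqrt θ • ξ‖ := by
      have := PiLp.norm_apply_le (u + Real.sqrt θ • ξ) k
      rwa [Real.norm_eq_abs] at this
    have h1 : ‖u + Real.sqrt θ • ξ‖ ≤ ‖u‖ + Real.sqrt θ * ‖ξ‖ := by
      refine (norm_add_le _ _).trans ?_
      rw [norm_smul, Real.norm_eq_abs, abs_of_nonneg (Real.sqrt_nonneg θ)]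
    refine hk.trans (h1.trans ?_)
    nlinarith [norm_nonneg u, Real.sqrt_nonneg θ, norm_nonneg ξ, sq_nonneg (‖ξ‖ - 1),
      mul_nonneg (Real.sqrt_nonneg θ) (sq_nonneg (‖ξ‖ - 1)), mul_nonneg (norm_nonneg u) (sq_nonneg ‖ξ‖)]
  -- assemble
  have hsum : Integrable (fun ξ : V3 => ∑ k, u k * (classF u A b G (u + Real.sqrt θ • ξ) *
      (u + Real.sqrt θ • ξ) k)) (stdGaussian V3) :=
    integrable_finsetSum _ fun k _ => (hik k).const_mul _
  have hpt : ∀ ξ : V3, classF u A b G (u + Real.sqrt θ • ξ) * ‖u + Real.sqrt θ • ξ‖ ^ 2 =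
      θ * (classF u A b G (u + Real.sqrt θ • ξ) * ‖ξ‖ ^ 2) +
        2 * (∑ k, u k * (classF u A b G (u + Real.sqrt θ • ξ) * (u + Real.sqrt θ • ξ) k)) -
        ‖u‖ ^ 2 * classF u A b G (u + Real.sqrt θ • ξ) := by
    intro ξ
    rw [hdec ξ, Finset.mul_sum, Finset.mul_sum]
    have : ∀ k : Fin 3, u k * (classF u A b G (u + Real.sqrt θ • ξ) * (u + Real.sqrt θ • ξ) k) =
        classF u A b G (u + Real.sqrt θ • ξ) * (u k * (u + Real.sqrt θ • ξ) k) := fun k => by ring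
    simp_rw [this, ← Finset.mul_sum]
    ring
  simp_rw [hpt]
  have hI1 : Integrable (fun ξ : V3 => θ * (classF u A b G (u + Real.sqrt θ • ξ) * ‖ξ‖ ^ 2) +
      2 * (∑ k, u k * (classF u A b G (u + Real.sqrt θ • ξ) * (u + Real.sqrt θ • ξ) k)))
      (stdGaussian V3) := (hiN.const_mul θ).add (hsum.const_mul 2)
  have hI2 : Integrable (fun ξ : V3 => ‖u‖ ^ 2 * classF u A b G (u + Real.sqrt θ • ξ)) (stdGaussian V3) :=
    hi1.const_mul _
  rw [integral_sub hI1 hI2, integral_add (hiN.const_mul θ) (hsum.const_mul 2), integral_const_mul,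
    integral_const_mul, integral_const_mul, integral_finsetSum _ fun k _ => (hik k).const_mul _]
  simp_rw [integral_const_mul, h2', mul_zero, Finset.sum_const_zero, mul_zero, add_zero, h1', mul_zero,
    sub_zero]
  rw [integral_classF_shift_mul_norm_sq u A b G hθ hC hG, htr]
  ring

/-- **The crux's third orthogonality hypothesis is implied by the first two** — in the exact form of
`OneFlightGossipEngine.KineticCurrentsWindowLDUniform`: for continuous profiles `θ₀ > 0`, `u₀`, coefficient
fields `A`, `b`, continuous `G : 𝕋³ × ℝ → ℝ` and the growth bound, `(∀ x, F(x,·) ⊥ 1) → (∀ x j, F(x,·) ⊥ v_j) →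
∀ x, F(x,·) ⊥ ‖v‖²` under `M_{1,θ₀(x),u₀(x)}`. [folklore] -/
theorem kcw_orth_energy_redundant (θ₀ : T3 → ℝ) (u₀ : T3 → V3) (hθ0 : ∀ x, 0 < θ₀ x)
    (A : T3 → Fin 3 → Fin 3 → ℝ) (b : T3 → V3) (G : T3 × ℝ → ℝ) (hG : Continuous G)
    (hC : ∃ C : ℝ, ∀ y : T3 × V3, |(fun y : T3 × V3 => ((∑ j : Fin 3, ∑ k : Fin 3, A y.1 j k *
      ((y.2 - u₀ y.1) j * (y.2 - u₀ y.1) k)) + (∑ j : Fin 3, b y.1 j * (y.2 - u₀ y.1) j) *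
        G (y.1, ‖y.2 - u₀ y.1‖ ^ 2))) y| ≤ C * (1 + ‖y.2‖ ^ 2))
    (h1 : ∀ x, ∫ v, (fun y : T3 × V3 => ((∑ j : Fin 3, ∑ k : Fin 3, A y.1 j k *
      ((y.2 - u₀ y.1) j * (y.2 - u₀ y.1) k)) + (∑ j : Fin 3, b y.1 j * (y.2 - u₀ y.1) j) *
        G (y.1, ‖y.2 - u₀ y.1‖ ^ 2))) (x, v) * localMaxwellian 1 (θ₀ x) (u₀ x) v = 0)
    (h2 : ∀ x (j : Fin 3), ∫ v, (fun y : T3 × V3 => ((∑ j : Fin 3, ∑ k : Fin 3, A y.1 j k *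
      ((y.2 - u₀ y.1) j * (y.2 - u₀ y.1) k)) + (∑ j : Fin 3, b y.1 j * (y.2 - u₀ y.1) j) *
        G (y.1, ‖y.2 - u₀ y.1‖ ^ 2))) (x, v) * v j * localMaxwellian 1 (θ₀ x) (u₀ x) v = 0) :
    ∀ x, ∫ v, (fun y : T3 × V3 => ((∑ j : Fin 3, ∑ k : Fin 3, A y.1 j k *
      ((y.2 - u₀ y.1) j * (y.2 - u₀ y.1) k)) + (∑ j : Fin 3, b y.1 j * (y.2 - u₀ y.1) j) *
        G (y.1, ‖y.2 - u₀ y.1‖ ^ 2))) (x, v) * ‖v‖ ^ 2 * localMaxwellian 1 (θ₀ x) (u₀ x) v = 0 := by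
  intro x
  obtain ⟨C, hC⟩ := hC
  have hFx : ∀ v : V3, (fun y : T3 × V3 => ((∑ j : Fin 3, ∑ k : Fin 3, A y.1 j k *
      ((y.2 - u₀ y.1) j * (y.2 - u₀ y.1) k)) + (∑ j : Fin 3, b y.1 j * (y.2 - u₀ y.1) j) *
        G (y.1, ‖y.2 - u₀ y.1‖ ^ 2))) (x, v) = classF (u₀ x) (A x) (b x) (fun s => G (x, s)) v := by
    intro v; rfl
  simp_rw [hFx] at h1 h2 ⊢
  refine orth_energy_of_orth_one_of_orth_mom (u₀ x) (A x) (b x) (fun s => G (x, s)) (hθ0 x) (C := C)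
    (fun v => ?_) (by fun_prop) (h1 x) (h2 x)
  have := hC (x, v)
  exact this

end KineticCurrentsWindowLDUniformClass
end Summit.AtomisticToContinuum.HydrodynamicLimit.Theorems

end
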